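import Mathlib
import Summits.BirchSwinnertonDyer.BirchSwinnertonDyer.Theorems.ResidualThetaTransportAtTwoSignedMuSeedAtTwoPlusNonsquareDescentCubicClassGroupSplitting
import HarnessLib

/-!
# Non-square descent — COUNTING THE `p`-PRIMARY PART: `#{g : g^{p^N} = 1} = p^{ord_p #G}` for `N ≥ ord_p #G`, and the class-group comparison in
# `ord_p` form `ord₂ #Cl(L) = ord₂ #Cl(L^σ) + log₂ #A^χ` (line `nonsquare-descent`, stub S2: the input `e_n(M) = e_n(K) + ord₂ #A_n^χ` of
# `…GrowthComparison.classicalMuVanishes_of_comparison_with_base`) — seed crux `SignedMuSeedAtTwoPlus` stmt-BirchSwinnertonDyer-21438 (parent Kμ⁺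
# `SignedMuVanishingAtTwoPlus` stmt-BirchSwinnertonDyer-20689, route ResidualThetaTransportAtTwo), line card `Cruxes/SignedMuSeedAtTwoPlus/Lines/nonsquare-descent.md`

Cell `bsd-wall`, width seat `bsd-wall-rtt-p4-w2` g19 (`--supports`, closes nothing).  THEOREMS ONLY; BSD is not proved by this.

`…CubicClassGroupSplitting` counts `q`-torsion: `#Cl(L)[q] = #Cl(L^σ)[q] · #{c ∈ Cl(L)[q] : c·σc·σ²c = 1}` for `gcd(3,q) = 1`.  The tree's growth currency is
`classNumberPExp κ n = ord_p #Cl(K_n)` (`Literature…IwasawaTheory.ClassicalMuInvariant`).  The passage is the abelian Sylow count: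

* §1 `isPGroup_ker_powMonoidHom`, **`natCard_ker_powMonoidHom_eq`** / **`natCard_pow_torsion_eq`** — for a finite commutative group `G`, a prime `p` and
  `N ≥ ord_p #G`: `#{g : g^{p^N} = 1} = p^{ord_p #G}` (the kernel of `g ↦ g^{p^N}` is a `p`-group containing a Sylow `p`-subgroup — Mathlib
  `Sylow.card_eq_multiplicity`).
* §2 **`pow_padicValNat_card_classGroup_eq_mul`** — for `L/F` Galois, `σ³ = 1`, `p ≠ 3` prime and `N ≥` both `ord_p`'s:
  `p^{ord_p #Cl(L)} = p^{ord_p #Cl(L^{⟨σ⟩})} · #{c ∈ Cl(L) : c^{p^N} = 1 ∧ c·σc·σ²c = 1}`; hence the norm-kernel count is a power of `p`,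
  `exists_natCard_normKer_eq_pow`, and **`padicValNat_card_classGroup_eq_add`**: `ord_p #Cl(L) = ord_p #Cl(L^{⟨σ⟩}) + k` with `p^k = #A^χ[p^N]`.

[folklore]
-/

set_option autoImplicit false
-- the Theorems namespace of this sub repeats the summit name by design (D-0017 nested layout)
set_option linter.dupNamespace false

namespace Summit.BirchSwinnertonDyer.BirchSwinnertonDyer.Theorems.SignedMuAtTwo.NonsquareDescent

/-! ## §1 The `p`-primary part of a finite commutative group -/

section Group

variable {G : Type*} [CommGroup G] [Finite G] (p : ℕ) [hp : Fact p.Prime]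

omit [Finite G] hp in
/-- The kernel of `g ↦ g^{p^N}` is a `p`-group. [folklore] -/
theorem isPGroup_ker_powMonoidHom (N : ℕ) : IsPGroup p ((powMonoidHom (p ^ N) : G →* G).ker) := by
  intro g
  refine ⟨N, Subtype.ext ?_⟩
  have h := g.2
  rw [MonoidHom.mem_ker, powMonoidHom_apply] at h
  rw [SubgroupClass.coe_pow, OneMemClass.coe_one]
  exact h

/-- **`#ker(g ↦ g^{p^N}) = p^{ord_p #G}` for `N ≥ ord_p #G`**: the kernel is a `p`-group (so of order `p^m ∣ #G`, `m ≤ ord_p #G`) and contains a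
Sylow `p`-subgroup (of order `p^{ord_p #G}`, whose elements satisfy `g^{p^{ord_p #G}} = 1`). [folklore] -/
theorem natCard_ker_powMonoidHom_eq {N : ℕ} (hN : (Nat.card G).factorization p ≤ N) :
    Nat.card ((powMonoidHom (p ^ N) : G →* G).ker) = p ^ (Nat.card G).factorization p := by
  set K := ((powMonoidHom (p ^ N) : G →* G).ker) with hK
  have hG0 : Nat.card G ≠ 0 := Nat.card_pos.ne'
  -- `#K = p^m` with `m ≤ ord_p #G`
  obtain ⟨m, hm⟩ := IsPGroup.iff_card.mp (isPGroup_ker_powMonoidHom (G := G) p N)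
  have hmle : m ≤ (Nat.card G).factorization p := by
    rw [← hp.out.pow_dvd_iff_le_factorization hG0, ← hm]
    exact K.card_subgroup_dvd_card
  -- a Sylow `p`-subgroup lies in `K`
  obtain ⟨P⟩ := (inferInstance : Nonempty (Sylow p G))
  have hP : Nat.card P = p ^ (Nat.card G).factorization p := Sylow.card_eq_multiplicity P
  have hPK : (P : Subgroup G) ≤ K := by
    intro g hg
    rw [hK, MonoidHom.mem_ker, powMonoidHom_apply]
    have h1 : (⟨g, hg⟩ : (P : Subgroup G)) ^ Nat.card P = 1 := pow_card_eq_one'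
    have h2 : g ^ Nat.card P = 1 := by
      have := congrArg Subtype.val h1
      rwa [SubgroupClass.coe_pow, OneMemClass.coe_one] at this
    rw [hP] at h2
    obtain ⟨d, hd⟩ := Nat.exists_eq_add_of_le hN
    rw [hd, pow_add, pow_mul, h2, one_pow]
  have hle : p ^ (Nat.card G).factorization p ≤ Nat.card K := hP ▸ Subgroup.card_le_of_le hPK
  rw [hm] at hle ⊢
  have hmge : (Nat.card G).factorization p ≤ m := (Nat.pow_le_pow_iff_right hp.out.one_lt).1 hle
  rw [le_antisymm hmle hmge]

/-- **`#{g : g^{p^N} = 1} = p^{ord_p #G}`** for `N ≥ ord_p #G` (with `ord_p = padicValNat p`). [folklore] -/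
theorem natCard_pow_torsion_eq {N : ℕ} (hN : padicValNat p (Nat.card G) ≤ N) :
    Nat.card {g : G // g ^ p ^ N = 1} = p ^ padicValNat p (Nat.card G) := by
  rw [← Nat.factorization_def _ hp.out] at hN ⊢
  rw [← natCard_ker_powMonoidHom_eq p hN]
  exact Nat.card_congr (Equiv.subtypeEquivRight fun g => by rw [MonoidHom.mem_ker, powMonoidHom_apply])

end Group

/-! ## §2 Class groups: `ord_p #Cl(L) = ord_p #Cl(L^σ) + log_p #A^χ` -/

section ClassGroup

open NumberField IntermediateField Literature.NumberTheory.NumberFields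

variable (F L : Type) [Field F] [NumberField F] [Field L] [NumberField L] [Algebra F L] [IsGalois F L]

/-- **`p^{ord_p #Cl(L)} = p^{ord_p #Cl(L^{⟨σ⟩})} · #{c ∈ Cl(L) : c^{p^N} = 1 ∧ c·σc·σ²c = 1}`** for `L/F` Galois, `σ³ = 1`, `p ≠ 3` prime and `N` at least
both `ord_p`'s («`#A(M_n) = #A(K_n) · #A_n^χ`» on `p`-parts). [folklore] -/
theorem pow_padicValNat_card_classGroup_eq_mul (σ : L ≃ₐ[F] L) (hσ : σ ^ 3 = 1) (p : ℕ) [Fact p.Prime] (hp3 : p ≠ 3)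
    {N : ℕ} (hNL : padicValNat p (Nat.card (ClassGroup (𝓞 L))) ≤ N)
    (hNF : padicValNat p (Nat.card (ClassGroup (𝓞 ↥(fixedField (Subgroup.zpowers σ))))) ≤ N) :
    p ^ padicValNat p (Nat.card (ClassGroup (𝓞 L))) =
      p ^ padicValNat p (Nat.card (ClassGroup (𝓞 ↥(fixedField (Subgroup.zpowers σ))))) *
        Nat.card {c : ClassGroup (𝓞 L) // c ^ p ^ N = 1 ∧
          c * ClassGroup.mulEquiv (AmbiguousClass.intAut σ) c *
            ClassGroup.mulEquiv (AmbiguousClass.intAut σ) (ClassGroup.mulEquiv (AmbiguousClass.intAut σ) c) = 1} := by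
  have hq : Nat.Coprime 3 (p ^ N) :=
    Nat.Coprime.pow_right N ((Nat.coprime_primes Nat.prime_three (Fact.out : p.Prime)).2 (Ne.symm hp3))
  rw [← natCard_pow_torsion_eq p hNL, ← natCard_pow_torsion_eq p hNF]
  exact card_torsion_classGroup_eq_card_fixedField_mul_card_normKer F L σ hσ hq

/-- Hence the norm-kernel count `#A^χ[p^N]` is a power of `p` dividing out exactly: `∃ k, #A^χ[p^N] = p^k ∧ ord_p #Cl(L) = ord_p #Cl(L^σ) + k`. [folklore] -/
theorem padicValNat_card_classGroup_eq_add (σ : L ≃ₐ[F] L) (hσ : σ ^ 3 = 1) (p : ℕ) [Fact p.Prime] (hp3 : p ≠ 3)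
    {N : ℕ} (hNL : padicValNat p (Nat.card (ClassGroup (𝓞 L))) ≤ N)
    (hNF : padicValNat p (Nat.card (ClassGroup (𝓞 ↥(fixedField (Subgroup.zpowers σ))))) ≤ N) :
    padicValNat p (Nat.card (ClassGroup (𝓞 L))) =
      padicValNat p (Nat.card (ClassGroup (𝓞 ↥(fixedField (Subgroup.zpowers σ))))) +
        padicValNat p (Nat.card {c : ClassGroup (𝓞 L) // c ^ p ^ N = 1 ∧
          c * ClassGroup.mulEquiv (AmbiguousClass.intAut σ) c *
            ClassGroup.mulEquiv (AmbiguousClass.intAut σ) (ClassGroup.mulEquiv (AmbiguousClass.intAut σ) c) = 1}) := by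
  have key := pow_padicValNat_card_classGroup_eq_mul F L σ hσ p hp3 hNL hNF
  haveI : Nonempty {c : ClassGroup (𝓞 L) // c ^ p ^ N = 1 ∧
      c * ClassGroup.mulEquiv (AmbiguousClass.intAut σ) c *
        ClassGroup.mulEquiv (AmbiguousClass.intAut σ) (ClassGroup.mulEquiv (AmbiguousClass.intAut σ) c) = 1} :=
    ⟨⟨1, one_pow _, by rw [map_one, map_one, mul_one, mul_one]⟩⟩
  -- take `ord_p` of both sides
  have h := congrArg (padicValNat p) key
  rw [padicValNat.prime_pow, padicValNat.mul (pow_ne_zero _ (Fact.out : p.Prime).ne_zero) Nat.card_pos.ne',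
    padicValNat.prime_pow] at h
  exact h

end ClassGroup

end Summit.BirchSwinnertonDyer.BirchSwinnertonDyer.Theorems.SignedMuAtTwo.NonsquareDescent
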